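import Summits.BirchSwinnertonDyer.BirchSwinnertonDyer.Theses.ByReductionTypeAtTwo
import Summits.BirchSwinnertonDyer.Rank1Residual.F1Sign2.DescentSignAtTwo
import Literature.NumberTheory.EllipticCurves.CongruenceNumber
import Mathlib.NumberTheory.Padics.PadicVal.Basic
import Mathlib.GroupTheory.Exponent
import HarnessLib.Audit.Tags
import HarnessLib

/-!
# ES-38 (cell bsd-f1-sign2, seat -es g29): LEVEL RAISING AT `ℓ = p = 2` — the 2-STABILISED PACKET of `f_E` in `S₂(Γ₀(2N); ℤ)`

Sketch (planner seat; statements only; nothing is a theorem beyond print; BSD is not proved).  For an elliptic curve `E/ℚ` of odd PRIME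
conductor `N` with `E[2]` irreducible, newform `f`, the packet `V_f = ⟨f(z), f(2z)⟩ ⊂ S₂(Γ₀(2N))` carries `U₂` with `U₂² − a₂U₂ + 2 = 0`;
for `a₂` odd (`E` ordinary at `2`) its unit root `α ∈ ℤ₂` (`α ≡ 3a₂ mod 8`) is the eigenvalue of the 2-stabilised form `f_α`.  The
objects below are the FORMS-SIDE congruence (fusion) modules `L ∩ (V ⊕ V′) / (L ∩ V + L ∩ V′)` (`L` = integral forms), which are
Pontryagin dual to the Hecke-ring-side modules `𝕋_V ⊗_{𝕋} 𝕋_{V′}` by the perfect pairing `S₂(Γ₀(M); ℤ) = Hom(𝕋_M, ℤ)`; ENGINE 38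
(kit, Sage modular symbols) computes the ring side 2-adically.
In print: Ribet 1990 (ℓ-free lemma `A ∩ B ≅ ker [[p+1, T_p],[T_p, p+1]]`, here `det = 9 − a₂² `), Tsaknias 2012 Thm 1.2 + remark `p = ℓ`
(anemic weak level raising mod `λⁿ`, `n = 2` at `a₂ = ±1`), Agashe–Ribet–Stein 2012 Thm 3.6(a) (`ñ_A ∣ r̃_A`: the LOWER BOUNDS `≥ 3`,
`≥ ord₂ m_E + 3` below).  Not in print (searched, NOTES ## presearch): the EQUALITIES (= ARS Thm 3.6(b) for the 2-old packet at
`2 ∥ 2N`, = the Wiles/DDT numerical criterion for raising the level at `ℓ = p = 2`), the SIGNED split, and their behaviour on Kilford's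
non-Gorenstein class (`Frob₂ = 1` on `E[2]`).
-/

open scoped Classical

noncomputable section

set_option linter.dupNamespace false
set_option autoImplicit false

namespace Summit.BirchSwinnertonDyer.BirchSwinnertonDyer.Theorems.RankOneAtTwoLevelRaisingAtTwo

open Literature.NumberTheory.EllipticCurves Literature.NumberTheory.EllipticCurves.ModularForms WeierstrassCurve
open CongruenceSubgroup
open Summit.BirchSwinnertonDyer.Rank1Residual.F1Sign2 (NoRationalTwoTorsion)

variable {M : ℕ} [NeZero M]

/-- `L ∩ V`: the forms with integral `q`-expansion inside a `ℂ`-subspace `V ⊆ S₂(Γ₀(M))`. -/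
def integralPart (V : Submodule ℂ (CuspForm (Gamma0 M) 2)) : Submodule ℤ (CuspForm (Gamma0 M) 2) :=
  integralCuspForms0 M 2 ⊓ V.restrictScalars ℤ

/-- `V^⊥`: the Petersson orthogonal complement of `V` in `S₂(Γ₀(M))` (as a `ℂ`-subspace). -/
def perp (V : Submodule ℂ (CuspForm (Gamma0 M) 2)) : Submodule ℂ (CuspForm (Gamma0 M) 2) :=
  ⨅ f : V, LinearMap.ker (peterssonProductₗ (Gamma0 M) 2 (f : CuspForm (Gamma0 M) 2))

/-- **The fusion (congruence) module of two subspaces** `V, V′ ⊆ S₂(Γ₀(M))`: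
`L ∩ (V + V′) ⧸ (L ∩ V + L ∩ V′)`, `L = S₂(Γ₀(M); ℤ)`.  For `V′ = V^⊥` and `V = ℂf` its order is the congruence number `r_f`
(ARS 2012 §2.1, tree `congruenceNumber`); for `V = S^{old}`, `V′ = S^{new}` it is Ribet's old/new fusion module. -/
abbrev fusionModule (V V' : Submodule ℂ (CuspForm (Gamma0 M) 2)) : Type :=
  ↥(integralPart (V ⊔ V')) ⧸ (integralPart V ⊔ integralPart V').comap (integralPart (V ⊔ V')).subtype

/-- Order of the fusion module (`0` = junk if infinite). -/
def fusionOrder (V V' : Submodule ℂ (CuspForm (Gamma0 M) 2)) : ℕ := Nat.card (fusionModule V V')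

/-- Exponent of the fusion module (ARS's `r̃`). -/
def fusionExponent (V V' : Submodule ℂ (CuspForm (Gamma0 M) 2)) : ℕ := AddMonoid.exponent (fusionModule V V')

/-- **The 2-stabilisation packet** `V_f = ℂ f(z) + ℂ f(2z) ⊆ S₂(Γ₀(2N))` of a level-`N` form (the two degeneracy images). -/
def twoPacket (N : ℕ) [NeZero N] [NeZero (2 * N)] (f : CuspForm (Gamma0 N) 2) :
    Submodule ℂ (CuspForm (Gamma0 (2 * N)) 2) :=
  Submodule.span ℂ {degeneracyMap0 N (2 * N) 1 2 f, degeneracyMap0 N (2 * N) 2 2 f}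

/-- The `U₂ = ε` part of the new subspace of `S₂(Γ₀(2N))` (`U₂ = heckeT _ 2 2` at a level divisible by `2`; on `2`-new forms
`U₂ = −w₂ = a₂ ∈ {±1}`).  For `N` prime the new subspace at level `2N` is exactly the `2`-new subspace (`S₂(Γ₀(2)) = 0`). -/
def signedNewPart (N : ℕ) [NeZero (2 * N)] (ε : ℤ) : Submodule ℂ (CuspForm (Gamma0 (2 * N)) 2) :=
  newSubspace0 (2 * N) 2 ⊓ LinearMap.ker (heckeT (Gamma0 (2 * N)) 2 2 - (ε : ℂ) • LinearMap.id)

/-- Class RAM of ES-38 (minimal discriminant `Δ ≡ 3 (mod 4)`, equivalently `ρ̄_{E,2}|_{D₂}` RAMIFIED for `E` ordinary at the good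
prime `2` with `E[2]` irreducible): the ordinary line of `E[2]` is pinned by inertia.  The other two classes are `Δ ≡ 5 (mod 8)` (UNS:
`Frob₂` a transposition on `E[2]`) and `Δ ≡ 1 (mod 8)` (TRIV: `Frob₂ = 1` on `E[2]`, Kilford–Wiese's non-Gorenstein levels). -/
def DiscThreeModFour (W : WeierstrassCurve ℚ) : Prop := W.Δ.num % 4 = 3

/-- Class TRIV of ES-38: minimal discriminant `Δ ≡ 1 (mod 8)` (`Frob₂` acts trivially on `E[2]`). -/
def DiscOneModEight (W : WeierstrassCurve ℚ) : Prop := W.Δ.num % 8 = 1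

/-- STANDING HYPOTHESES of ES-38: `N` an odd prime, `W` a globally minimal elliptic curve whose newform is `f ∈ S₂(Γ₀(N))` (so `N` is the
conductor), `E[2]` irreducible (no rational `2`-torsion), `E` ORDINARY at `2` (`a₂` odd). -/
structure Setting (N : ℕ) [NeZero N] (W : WeierstrassCurve ℚ) (f : CuspForm (Gamma0 N) 2) : Prop where
  prime : N.Prime
  odd : Odd N
  newform : IsNewformOf W f
  irred : NoRationalTwoTorsion W
  ordinary : Odd (W.LFunction 2)

/-- **ES-38R `TwoNewFusionOrderAtTwo` (control; lower bound `≥ 3` is Ribet 1990 + ARS 3.6(a) in substance).**  In the Setting, the fusion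
module of the 2-stabilisation packet with the (2-)new subspace of `S₂(Γ₀(2N))` has order exactly `2³ · odd`
(ring side: `ℤ[U₂|V_f] / π_f(Ann 𝕋(S^{new})) ⊗ ℤ₂ ≅ ℤ/8` on the `α`-line).  ENGINE 38 key `fusion_full.v2 = 3`, `alpha.new = 3`, `beta.new = 0`. -/
@[conjecture] def TwoNewFusionOrderAtTwo : Prop :=
  ∀ (N : ℕ) [NeZero N] [NeZero (2 * N)] (W : WeierstrassCurve ℚ) [W.IsElliptic] [W.IsGloballyMinimal]
    (f : CuspForm (Gamma0 N) 2), Setting N W f →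
      padicValNat 2 (fusionOrder (twoPacket N f) (newSubspace0 (2 * N) 2)) = 3

/-- **ES-38R₀ `TwoNewFusionLowerBoundAtTwo` (the IN-PRINT-SHAPED half of ES-38R; first rung / prover target).**  In the Setting, `8 ∣ #M(V_f, S^{new})`:
Ribet's `δ^∨ ∘ δ = [[3, T₂],[T₂, 3]]` on `V_f ⊕ V_f` has determinant `9 − a₂² = 8 · odd` (Ribet 1984/1990 ℓ-free lemma, stated for the Jacobian; the forms-lattice
version at `p = 2` is what is asserted here).  Together with `U₂ ≡ 3a₂ (mod #M_α)`, `M_β = 0`, `9 ≡ 1 (mod #M)` it yields ES-38R. -/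
@[conjecture] def TwoNewFusionLowerBoundAtTwo : Prop :=
  ∀ (N : ℕ) [NeZero N] [NeZero (2 * N)] (W : WeierstrassCurve ℚ) [W.IsElliptic] [W.IsGloballyMinimal]
    (f : CuspForm (Gamma0 N) 2), Setting N W f →
      8 ∣ fusionOrder (twoPacket N f) (newSubspace0 (2 * N) 2)

/-- ES-38R ⟹ ES-38R₀ (bookkeeping; `fusionOrder = 0` is the junk value of an infinite quotient, and `padicValNat 2 0 = 0 ≠ 3`, so ES-38R also
asserts finiteness). -/
theorem twoNewFusionLowerBoundAtTwo_of_order (h : TwoNewFusionOrderAtTwo) : TwoNewFusionLowerBoundAtTwo := by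
  intro N _ _ W _ _ f hS
  have h3 := h N W f hS
  have hne : fusionOrder (twoPacket N f) (newSubspace0 (2 * N) 2) ≠ 0 := by
    intro h0; rw [h0, padicValNat_zero_right] at h3; exact absurd h3 (by norm_num)
  have := (padicValNat_dvd_iff_le (p := 2) (n := 3) hne).mpr (by omega)
  simpa using this

/-- **ES-38H `TwoStabilisedPacketExponentAtTwo` (the numerical criterion for raising the level AT `ℓ = p = 2` on the `α`-line; = ARS
Thm 3.6(b) for the 2-old packet at `2 ∥ 2N`; NOT in print).**  In the Setting, the congruence EXPONENT of the packet `V_f ⊂ S₂(Γ₀(2N))`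
(fusion with its Petersson complement) satisfies `ord₂ r̃(V_f) = ord₂ r_f + 3`, `r_f` = congruence number of `f` at level `N` (tree
`congruenceNumber`; `= m_E` 2-adically, ARS Thm 2.1): the `α`-line of the packet is congruent to the rest of `S₂(Γ₀(2N); ℤ₂)` to depth EXACTLY
`ord₂ r_f` (old forms) `+ 3` (2-new forms) and the two fuse cyclically.  ENGINE 38/38C key `alpha.comp = v2m + 3` (all classes RAM/UNS/TRIV).
The in-print half is `≥` (ARS 3.6(a) with Ribet's `δ^∨δ = [[3, T₂],[T₂, 3]]`). -/
@[conjecture] def TwoStabilisedPacketExponentAtTwo : Prop :=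
  ∀ (N : ℕ) [NeZero N] [NeZero (2 * N)] (W : WeierstrassCurve ℚ) [W.IsElliptic] [W.IsGloballyMinimal]
    (f : CuspForm (Gamma0 N) 2), Setting N W f →
      padicValNat 2 (fusionExponent (twoPacket N f) (perp (twoPacket N f))) = padicValNat 2 (congruenceNumber f) + 3

/-- **ES-38B `TwoStabilisedPacketOrderAtTwo` (β-line RIGIDITY in the ramified class; NOT in print).**  In the Setting and in class RAM
(`Δ ≡ 3 (mod 4)`), the ORDER of the packet's congruence module is `2^{2 ord₂ r_f + 3} · odd`: `α`-line `ord₂ r_f + 3`, `β`-line EXACTLY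
`ord₂ r_f` — the `β`-stabilised line `f_β` (on which `U₂` is topologically nilpotent) acquires NO congruence beyond those of `f`.  Reason offered:
`v₂(β_f − β_h) = v₂(a₂(f) − a₂(h)) + 1` for a congruent ordinary `h`, so the `β`-line gains a bit exactly when `T₂` is the strict bottleneck of
the level-`N` congruence `f ≡ h`, which a ramified `ρ̄|_{D₂}` forbids (the ordinary line is pinned by inertia); in classes UNS/TRIV the gain
occurs (229a1, 139a1: `+1`).  ENGINE 38C key `beta.comp − v2m = 0` on RAM. -/
@[conjecture] def TwoStabilisedPacketOrderAtTwo : Prop :=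
  ∀ (N : ℕ) [NeZero N] [NeZero (2 * N)] (W : WeierstrassCurve ℚ) [W.IsElliptic] [W.IsGloballyMinimal]
    (f : CuspForm (Gamma0 N) 2), Setting N W f → DiscThreeModFour W →
      padicValNat 2 (fusionOrder (twoPacket N f) (perp (twoPacket N f))) = 2 * padicValNat 2 (congruenceNumber f) + 3

/-- **ES-38B′ `BetaLineSlackAtTwo` (NOT in print).**  In the Setting (any class), the `β`-line gains AT MOST ONE bit:
`ord₂ #(packet congruence module) − (2 ord₂ r_f + 3) ∈ {0, 1}`.  ENGINE 38C key `beta.comp − v2m ∈ {0,1}`. -/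
@[conjecture] def BetaLineSlackAtTwo : Prop :=
  ∀ (N : ℕ) [NeZero N] [NeZero (2 * N)] (W : WeierstrassCurve ℚ) [W.IsElliptic] [W.IsGloballyMinimal]
    (f : CuspForm (Gamma0 N) 2), Setting N W f →
      padicValNat 2 (fusionOrder (twoPacket N f) (perp (twoPacket N f))) = 2 * padicValNat 2 (congruenceNumber f) + 3 ∨
      padicValNat 2 (fusionOrder (twoPacket N f) (perp (twoPacket N f))) = 2 * padicValNat 2 (congruenceNumber f) + 4

/-- **ES-38S `SignedTwoNewDepthAtTwo` (signed Ihara lemma at `ℓ = p = 2`; NOT in print).**  In the Setting, for `ε = ±1` the fusion module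
of `V_f` with the `U₂ = ε` new part has order `2^{1 + [ε = −a₂(E)]} · odd`: the mod-4 level-raising congruence of `f_α` lives on the
2-new forms with `a₂(g) = −a₂(E)` (`α ≡ −a₂ mod 4`), the `a₂(g) = a₂(E)` part sees `f` only mod 2; `1 + 2 = 3` is FUSED in ES-38R.
ENGINE 38 keys `alpha.newP`, `alpha.newM` (`= v₂(α − 1)`, `v₂(α + 1)`). -/
@[conjecture] def SignedTwoNewDepthAtTwo : Prop :=
  ∀ (N : ℕ) [NeZero N] [NeZero (2 * N)] (W : WeierstrassCurve ℚ) [W.IsElliptic] [W.IsGloballyMinimal]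
    (f : CuspForm (Gamma0 N) 2), Setting N W f → ∀ ε : ℤ, ε = 1 ∨ ε = -1 →
      padicValNat 2 (fusionOrder (twoPacket N f) (signedNewPart N ε)) = (if ε = -W.LFunction 2 then 2 else 1)

/-- **ES-38P `SupersingularNoTwoNewFusion` (control, in print in substance: Ribet's `det = 9 − a₂²` is odd).**  `N` odd prime, `E[2]`
irreducible, `E` SUPERSINGULAR at `2` (`a₂` even) ⇒ the packet/new fusion module at level `2N` has ODD order: no level raising to `2`
modulo any power of `2`.  ENGINE 38 keys `an.new = 0`, `fusion_full.v2 = 0` on class SS. -/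
@[conjecture] def SupersingularNoTwoNewFusion : Prop :=
  ∀ (N : ℕ) [NeZero N] [NeZero (2 * N)] (W : WeierstrassCurve ℚ) [W.IsElliptic] [W.IsGloballyMinimal]
    (f : CuspForm (Gamma0 N) 2), N.Prime → Odd N → IsNewformOf W f → NoRationalTwoTorsion W → Even (W.LFunction 2) →
      ¬ 2 ∣ fusionOrder (twoPacket N f) (newSubspace0 (2 * N) 2)

/-- **ES-38P′ `SupersingularPacketOrderAtTwo` (control).**  `N` odd prime, `E[2]` irreducible, `E` SUPERSINGULAR at `2` ⇒ the packet's
congruence module at level `2N` has order `2^{2 ord₂ r_f} · odd` (both stabilisation directions carry exactly the congruences of `f`; Ribet's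
`det [[3, a₂],[a₂, 3]] = 9 − a₂²` is odd).  ENGINE 38C key `comp.v2 = 2 v2m` on class SS. -/
@[conjecture] def SupersingularPacketOrderAtTwo : Prop :=
  ∀ (N : ℕ) [NeZero N] [NeZero (2 * N)] (W : WeierstrassCurve ℚ) [W.IsElliptic] [W.IsGloballyMinimal]
    (f : CuspForm (Gamma0 N) 2), N.Prime → Odd N → IsNewformOf W f → NoRationalTwoTorsion W → Even (W.LFunction 2) →
      padicValNat 2 (fusionOrder (twoPacket N f) (perp (twoPacket N f))) = 2 * padicValNat 2 (congruenceNumber f)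

/-- ES-38B follows from ES-38B′ together with "no slack in class RAM" — recorded only to fix the logical shape (both are conjectures). -/
theorem twoStabilisedPacketOrderAtTwo_of_slack_zero
    (h : ∀ (N : ℕ) [NeZero N] [NeZero (2 * N)] (W : WeierstrassCurve ℚ) [W.IsElliptic] [W.IsGloballyMinimal]
      (f : CuspForm (Gamma0 N) 2), Setting N W f → DiscThreeModFour W →
      padicValNat 2 (fusionOrder (twoPacket N f) (perp (twoPacket N f))) ≠ 2 * padicValNat 2 (congruenceNumber f) + 4)
    (hB : BetaLineSlackAtTwo) : TwoStabilisedPacketOrderAtTwo := by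
  intro N _ _ W _ _ f hS hR
  rcases hB N W f hS with h1 | h1
  · exact h1
  · exact absurd h1 (h N W f hS hR)

end Summit.BirchSwinnertonDyer.BirchSwinnertonDyer.Theorems.RankOneAtTwoLevelRaisingAtTwo

end
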